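import Literature.NumberTheory.Automorphic.ThorneQInfinityModularProofs
import Literature.NumberTheory.Automorphic.SolvableBaseChangeModularityTowerProofs
import HarnessLib

/-!
# Thorne 2019, Lemma 3 for `[K : ℚ] > 1`, from modularity lifting and the three printed inputs of
# cyclic base change (proofs)

Topic `Literature/NumberTheory/Automorphic`; a *proofs* file (theorems only: no definition, no
named fact, no instance), the junction of the two discharge programmes of
`Literature.NumberTheory.Automorphic.Thorne2019_lemma3` (`ThorneQInfinityModular`; Thorne,
*Elliptic curves over `ℚ_∞` are modular*, JEMS 21 (2019), Lemma 3):

* `ThorneQInfinityModularProofs.Thorne2019_lemma3_of_facts` closed Lemma 3 modulo the two named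
  facts `Box2022_theorem1_3` (modularity lifting at `3` and `5`) and
  `isModularEllipticCurve_baseChange_rat_of_isSolvable` (modularity of `E₀ ⊗ K` for `E₀ / ℚ`);
* `SolvableBaseChangeModularityTowerProofs` proved the latter for every `K` with `[K : ℚ] > 1`
  from the Modularity Theorem over `ℚ` (`exists_isNewformOf`), Arthur–Clozel's cyclic base change
  of prime degree (`baseChange_cyclic_cuspidal`) and its archimedean component
  (`ArthurClozel1989_strongLifting_archimedean`).

Since the base-change fact enters Thorne's argument only at the field `K` of the curve (through
the "door" `isModularEllipticCurve_of_jInvariant_eq_ratCast`), the two combine: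

* `isModularEllipticCurve_of_jInvariant_eq_ratCast_of_forall_baseChange` — the door with the
  base-change input localised at `K`;
* `Thorne2019_lemma3_of_forall_baseChange` — Lemma 3 at a fixed `K`, from `Box2022_theorem1_3`
  and the modularity of all `E₀ ⊗ K`, `E₀ / ℤ`;
* `Thorne2019_lemma3_of_facts_of_one_lt_finrank` — **Lemma 3 for every `K` with `[K : ℚ] > 1`,
  from `Box2022_theorem1_3`, `exists_isNewformOf`, `baseChange_cyclic_cuspidal` and
  `ArthurClozel1989_strongLifting_archimedean`.**

(The excluded fields are those of degree `1` over `ℚ`, for which Lemma 3 is the Modularity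
Theorem over a copy of `ℚ`; see the module docstring of `SolvableBaseChangeModularityTowerProofs`.)

## References

* J. A. Thorne, *Elliptic curves over `ℚ_∞` are modular*, J. Eur. Math. Soc. 21 (2019),
  Lemma 3, Prop. 4, Thm. 2. [Thorne2019]
* J. A. Thorne, *Automorphy of some residually dihedral Galois representations*, Math. Ann. 364
  (2016), Lemma 7.1. [Thorne2016]
* N. Freitas, B. V. Le Hung, S. Siksek, *Elliptic curves over real quadratic fields are
  modular*, Invent. Math. 201 (2015), §5 (p. 33). [FreitasLeHungSiksek2015]
-/

noncomputable section

namespace Literature.NumberTheory.Automorphic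

open scoped _root_.NumberField MatrixGroups
open _root_.NumberField _root_.Field Literature.NumberTheory.GaloisRepresentations

/-- **The door, with the base-change input at `K` only**: over a totally real `K` such that
`E₀ ⊗ 𝓞 K` is modular for every integral `E₀ / ℤ` with `Δ(E₀) ≠ 0`, a model `E / 𝓞 K` with
`Δ(E) ≠ 0` and rational `j`-invariant `j₀ ∉ {0, 1728}` is modular: `E₀ = ratJModel j₀.num j₀.den`
has `j`-invariant `j₀` (`ratJModel_c₄_pow_three_div_Δ`) and `isModularEllipticCurve_of_jInvariant_eq`
(proved: `isModularEllipticCurve_of_jInvariant_eq_holds`) transfers modularity along equal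
`j ∉ {0, 1728}`.  (Proof of `isModularEllipticCurve_of_jInvariant_eq_ratCast` verbatim, with the
named fact replaced by its instance at `K`.) [cite: FreitasLeHungSiksek2015, §5 (p. 33)] -/
theorem isModularEllipticCurve_of_jInvariant_eq_ratCast_of_forall_baseChange
    (K : Type) [Field K] [NumberField K] [IsTotallyReal K]
    (hBCK : ∀ E₀ : WeierstrassCurve ℤ, E₀.Δ ≠ 0 → IsModularEllipticCurve K (E₀.baseChange (𝓞 K)))
    (E : WeierstrassCurve (𝓞 K)) (hΔ : E.Δ ≠ 0) (j₀ : ℚ) (hj₀ : j₀ ≠ 0) (hj₁ : j₀ ≠ 1728)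
    (hj : (algebraMap (𝓞 K) K E.c₄) ^ 3 / algebraMap (𝓞 K) K E.Δ = (j₀ : K)) :
    IsModularEllipticCurve K E := by
  -- the integral model `ratJModel p q` over `ℤ` of `j`-invariant `j₀ = p / q`
  set p : ℤ := j₀.num with hp_def
  set q : ℤ := (j₀.den : ℤ) with hq_def
  have hq : q ≠ 0 := by rw [hq_def]; exact_mod_cast j₀.den_nz
  have hp : p ≠ 0 := Rat.num_ne_zero.2 hj₀
  have hpq : p ≠ 1728 * q := by
    intro h
    apply hj₁
    have hq' : (j₀.den : ℚ) ≠ 0 := by exact_mod_cast j₀.den_nz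
    calc j₀ = (j₀.num : ℚ) / j₀.den := (Rat.num_div_den j₀).symm
      _ = ((1728 * (j₀.den : ℤ) : ℤ) : ℚ) / j₀.den := by
          rw [show j₀.num = 1728 * (j₀.den : ℤ) from h]
      _ = 1728 := by push_cast; field_simp
  have hE₀ : (ratJModel p q).Δ ≠ 0 := ratJModel_Δ_ne_zero hp hq hpq
  -- the base change of `E₀ / ℚ` to `K` is modular
  have hmod : IsModularEllipticCurve K ((ratJModel p q).baseChange (𝓞 K)) :=
    hBCK (ratJModel p q) hE₀
  -- its `j`-invariant is `j₀`
  have hj' : (algebraMap (𝓞 K) K ((ratJModel p q).baseChange (𝓞 K)).c₄) ^ 3 /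
      algebraMap (𝓞 K) K ((ratJModel p q).baseChange (𝓞 K)).Δ = (j₀ : K) := by
    simp only [WeierstrassCurve.baseChange, WeierstrassCurve.map_c₄, WeierstrassCurve.map_Δ,
      eq_intCast, map_intCast]
    rw [ratJModel_c₄_pow_three_div_Δ hp hq hpq K, hp_def, hq_def, Int.cast_natCast,
      Rat.cast_def]
  have hΔ₀ : ((ratJModel p q).baseChange (𝓞 K)).Δ ≠ 0 := by
    simp only [WeierstrassCurve.baseChange, WeierstrassCurve.map_Δ, eq_intCast]
    exact_mod_cast hE₀
  -- twist invariance (proved fact): same `j ∉ {0, 1728}`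
  refine isModularEllipticCurve_of_jInvariant_eq_holds K ((ratJModel p q).baseChange (𝓞 K)) E hΔ₀
    hΔ (hj'.trans hj.symm) ?_ ?_ hmod
  · rw [hj']; exact_mod_cast hj₀
  · rw [hj']; exact_mod_cast hj₁

/-- **Thorne 2019, Lemma 3 (2) at a fixed field `K`, from `Box2022_theorem1_3` and the modularity
of all base changes `E₀ ⊗ K` of integral curves `E₀ / ℤ`.**  The proof of
`Thorne2019_lemma3_of_facts` verbatim (level structures of a non-modular curve from
`Box2022_theorem1_3`; the moduli interpretations `Thorne2019.moduli_X0_15`,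
`exists_ratCast_eq_of_pointsRational`, `exists_ratCast_j_of_splitCartan` give `j(E) ∈ ℚ`; CM for
`j ∈ {0, 1728}`), closed by the localised door
`isModularEllipticCurve_of_jInvariant_eq_ratCast_of_forall_baseChange`.
[cite: Thorne2019, Lemma 3 (2) and its proof, Prop. 4, Thm. 2] -/
theorem Thorne2019_lemma3_of_forall_baseChange (hBox : Box2022_theorem1_3)
    (K : Type) [Field K] [NumberField K] [IsTotallyReal K] (h5 : ¬ IsSquare (5 : K))
    [IsGalois ℚ K] [IsCyclic (K ≃ₐ[ℚ] K)]
    (h₁ : Thorne2019.PointsRational Thorne2019.E₁ K) (h₂ : Thorne2019.PointsRational Thorne2019.E₂ K)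
    (hBCK : ∀ E₀ : WeierstrassCurve ℤ, E₀.Δ ≠ 0 → IsModularEllipticCurve K (E₀.baseChange (𝓞 K)))
    (E : WeierstrassCurve (𝓞 K)) (hΔ : E.Δ ≠ 0) : IsModularEllipticCurve K E := by
  by_contra hE
  -- part (1): level structures of a non-modular curve (`Box2022_theorem1_3` (i), (ii))
  have hnA : ¬ IsAutomorphicOfWeightZero E :=
    not_isAutomorphicOfWeightZero_of_not_isModularEllipticCurve hΔ hE
  obtain ⟨⟨ρ₃, hρ₃, h3⟩, h5', -⟩ := hBox K E hΔ hnA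
  obtain ⟨ρ₅, hρ₅, hb5⟩ := h5' h5
  -- the moduli interpretations and `X(K) = X(ℚ)`: `j(E)` is rational
  have hjrat : ∃ j₀ : ℚ, (algebraMap (𝓞 K) K E.c₄) ^ 3 / algebraMap (𝓞 K) K E.Δ = (j₀ : K) := by
    rcases h3 with hb3 | hs3
    · obtain ⟨S, Jn, Jd, hX⟩ := Thorne2019.moduli_X0_15
      rcases hX K E hΔ ⟨ρ₃, hρ₃, hb3⟩ ⟨ρ₅, hρ₅, hb5⟩ with ⟨j₀, -, hj⟩ | ⟨x, y, hxy, hJd, hJ⟩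
      · exact ⟨j₀, hj⟩
      · exact Thorne2019.exists_ratCast_eq_of_pointsRational h₁ hxy hJd hJ
    · exact Thorne2019.exists_ratCast_j_of_splitCartan h₁ h₂ E hΔ ⟨ρ₃, hρ₃, hs3⟩ ⟨ρ₅, hρ₅, hb5⟩
  obtain ⟨j₀, hj⟩ := hjrat
  -- `j ∈ {0, 1728}`: geometric CM, hence modular in the Caraiani–Newton sense
  letI := FLS2015.isElliptic_baseChange (K := K) hΔ
  have hjK : (E.baseChange K).j = (j₀ : K) := (j_baseChange_eq_div hΔ).trans hj
  by_cases h0 : j₀ = 0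
  · refine hE (IsModularEllipticCurve.of_hasCM (WeierstrassCurve.HasCM.of_j_eq_zero ?_))
    rw [hjK, h0, Rat.cast_zero]
  by_cases h1728 : j₀ = 1728
  · refine hE (IsModularEllipticCurve.of_hasCM (WeierstrassCurve.HasCM.of_j_eq_1728 ?_))
    rw [hjK, h1728]
    norm_num
  -- `j ∉ {0, 1728}`: base change + quadratic twist
  exact hE (isModularEllipticCurve_of_jInvariant_eq_ratCast_of_forall_baseChange K hBCK E hΔ j₀
    h0 h1728 hj)

/-- **Thorne 2019, Lemma 3 (2) for every `K` with `[K : ℚ] > 1`, from modularity lifting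
(`Box2022_theorem1_3`) and the three printed inputs of "all elliptic curves over `ℚ` are modular
+ cyclic base change"**: the Modularity Theorem over `ℚ` (`exists_isNewformOf`), Arthur–Clozel's
cyclic base change of prime degree (`baseChange_cyclic_cuspidal`) and its archimedean component
(`ArthurClozel1989_strongLifting_archimedean`), through
`isModularEllipticCurve_baseChange_of_one_lt_finrank` (the cyclic group `Gal(K/ℚ)` is solvable).
Verbatim `Thorne2019_lemma3` with the extra hypothesis `1 < [K : ℚ]`.
[cite: Thorne2019, Lemma 3 (2) and its proof, Prop. 4, Thm. 2] [cite: Thorne2016, Lemma 7.1] -/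
theorem Thorne2019_lemma3_of_facts_of_one_lt_finrank (hBox : Box2022_theorem1_3)
    (hA : EllipticCurves.ModularForms.exists_isNewformOf) (hBC : baseChange_cyclic_cuspidal)
    (hArch : ArthurClozel1989_strongLifting_archimedean) :
    ∀ (K : Type) [Field K] [NumberField K], IsTotallyReal K → ¬ IsSquare (5 : K) →
      IsGalois ℚ K → IsCyclic (K ≃ₐ[ℚ] K) →
        Thorne2019.PointsRational Thorne2019.E₁ K → Thorne2019.PointsRational Thorne2019.E₂ K →
          1 < Module.finrank ℚ K →
            ∀ E : WeierstrassCurve (𝓞 K), E.Δ ≠ 0 → IsModularEllipticCurve K E := by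
  intro K _ _ hK h5 hG hC h₁ h₂ hdeg E hΔ
  haveI := hK
  haveI := hG
  haveI := hC
  haveI : IsSolvable (K ≃ₐ[ℚ] K) := isSolvable_of_comm mul_comm'
  exact Thorne2019_lemma3_of_forall_baseChange hBox K h5 h₁ h₂
    (fun E₀ hE₀ => isModularEllipticCurve_baseChange_of_one_lt_finrank hA hBC hArch K hdeg E₀ hE₀)
    E hΔ

end Literature.NumberTheory.Automorphic
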